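import Literature.MathematicalPhysics.QuantumFieldTheory.CurvatureGaussianField
import Literature.Probability.LatticeModels.LatticeGreenGradient
import HarnessLib

/-!
# `SourcedPressureIncrement` (stmt-QuantumFields-22517), line `birth`: decay of the curvature (lattice Maxwell field-strength)
# two-point kernel between parallel plaquettes (helper toward the second cumulant of `stub_gauss`)

For the two-plaquette kernel `curvatureTwoPoint` of `CurvatureGaussianField.lean` (`(d(-Δ)⁻¹d*)(p, q)`, the covariance
of the gradient spin-wave / lattice Maxwell field strength on `ℤ^d`) and two PARALLEL plaquettes `p = (x; i<j)`,
`q = (y; i<j)`: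

* `curvatureTwoPoint_parallel_eq` — the kernel is the transverse second difference of the Green function of `ℤ^d`:
  `curvatureTwoPoint (x; i,j) (y; i,j) = −[ΔᵢG(z) + ΔⱼG(z)]/2`, `z = x − y`, `Δ_m G(z) = G(z+e_m) + G(z−e_m) − 2G(z)`,
  `G = latticeGreen` (the eight same-direction pairs of boundary edges; Garban–Sepúlveda 2023 §4);
* `abs_latticeGreen_second_diff_le` — `|Δ_m G(z)| ≤ C |z|^{−d}` for `z ≠ 0` (from the tree's printed Lawler asymptotics
  `latticeGreen_second_diff_continuum`, Lawler (1.37));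
* `exists_abs_curvatureTwoPoint_parallel_le` — **`|curvatureTwoPoint (x;i,j) (y;i,j)| ≤ C |x − y|^{−d}`** for `x ≠ y`, and
  `exists_abs_curvatureTwoPoint_parallel_le_one_add` — `≤ C' (1 + |x − y|)^{−d}` for all `x, y`
  (`|·|` the Euclidean norm); in particular the axis numbers `curvaturePlaquetteCorr d n = O(|n|^{−d})`
  (`abs_curvaturePlaquetteCorr_le`), the CEILING matching the tree's floor `WeakCouplingRates.curvatureCorrPowerFloor_proof`
  (`κ/n⁴ ≤ |c_n|` in `d = 4`).

This is the square-summability input (`Σ_y C(x,y)² < ∞` in `d = 4`) for second cumulants of quadratic composites of the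
curvature field (route `SourcedPressureJensen`, crux `SourcedPressureIncrement`, stub `stub_gauss`: `Var_γ(H_B) ≤ M₂|B|`; also
route `EntropyBudgetEquipartition`).  Imports Literature only (no route file).  Everything here is proved; no definition, no named
fact.  RECORD-label rung support; the Yang–Mills mass gap is NOT proved by anything here.  Sources: Lawler, *Intersections of
random walks* (1991) Thm 1.5.5; Garban–Sepúlveda, IMRN 2023 §4. [folklore]
-/

noncomputable section

open Finset Real
open Literature.Probability.LatticeModels Literature.MathematicalPhysics.QuantumLattice

namespace Summit.QuantumFields.YangMills.Cruxes.SourcedPressureIncrement.Birth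

open Literature.MathematicalPhysics.QuantumFieldTheory

variable {d : ℕ}

/-- **Parallel plaquettes: the curvature two-point kernel is the transverse second difference of the Green function.**
For `p = (x; i<j)`, `q = (y; i<j)` and `z = x − y`:
`curvatureTwoPoint p q = −[(G(z+eᵢ) + G(z−eᵢ) − 2G(z)) + (G(z+eⱼ) + G(z−eⱼ) − 2G(z))]/2`, `G = latticeGreen` — of the
sixteen pairs of boundary edges only the eight same-direction pairs contribute (`edgeGreen` is diagonal in the direction,
with value `G/2`). [folklore] -/
theorem curvatureTwoPoint_parallel_eq (x y : Literature.Probability.LatticeModels.Site d) (ij : {p : Fin d × Fin d // p.1 < p.2}) :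
    curvatureTwoPoint ((x, ij) : ZdPlaquette d) (y, ij) =
      -((latticeGreen (x - y + Pi.single ij.1.1 1) + latticeGreen (x - y - Pi.single ij.1.1 1) -
            2 * latticeGreen (x - y)) +
          (latticeGreen (x - y + Pi.single ij.1.2 1) + latticeGreen (x - y - Pi.single ij.1.2 1) -
            2 * latticeGreen (x - y))) / 2 := by
  obtain ⟨⟨i, j⟩, hij⟩ := ij
  have hne : i ≠ j := ne_of_lt hij
  have hne' : j ≠ i := fun h => hne h.symm
  simp only [curvatureTwoPoint, Fin.sum_univ_four, plaquetteBoundary, plaquetteBoundarySign, edgeGreen_apply,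
    Matrix.cons_val_zero, Matrix.cons_val_one, Matrix.cons_val, if_true, hne, hne', if_false]
  have e1 : x - (y + Pi.single j 1) = x - y - Pi.single j 1 := by abel
  have e2 : x + Pi.single j 1 - y = x - y + Pi.single j 1 := by abel
  have e3 : x + Pi.single j 1 - (y + Pi.single j 1) = x - y := by abel
  have e4 : x + Pi.single i 1 - (y + Pi.single i 1) = x - y := by abel
  have e5 : x + Pi.single i 1 - y = x - y + Pi.single i 1 := by abel
  have e6 : x - (y + Pi.single i 1) = x - y - Pi.single i 1 := by abel
  simp only [e1, e2, e3, e4, e5, e6]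
  ring

/-- For a nonzero integer vector the Euclidean norm is at least `1`. [folklore] -/
theorem one_le_sqrt_sum_sq_of_ne_zero {z : Literature.Probability.LatticeModels.Site d} (hz : z ≠ 0) :
    1 ≤ Real.sqrt (∑ j, ((z j : ℤ) : ℝ) ^ 2) := by
  obtain ⟨k, hk⟩ : ∃ k, z k ≠ 0 := by
    obtain ⟨k, hk⟩ := Function.ne_iff.mp hz
    exact ⟨k, by simpa using hk⟩
  have h1 : (1 : ℝ) ≤ ((z k : ℤ) : ℝ) ^ 2 := by
    have : (1 : ℤ) ≤ (z k) ^ 2 := by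
      rcases lt_or_gt_of_ne hk with h | h <;> nlinarith
    exact_mod_cast this
  have h2 : ((z k : ℤ) : ℝ) ^ 2 ≤ ∑ j, ((z j : ℤ) : ℝ) ^ 2 :=
    Finset.single_le_sum (f := fun j => ((z j : ℤ) : ℝ) ^ 2) (fun j _ => sq_nonneg _) (Finset.mem_univ k)
  rw [show (1 : ℝ) = Real.sqrt 1 from Real.sqrt_one.symm]
  exact Real.sqrt_le_sqrt (by linarith)

/-- **Second differences of the Green function decay like `|z|^{−d}`**: there is `C` with
`|G(z+e_m) + G(z−e_m) − 2G(z)| ≤ C |z|^{−d}` for all `z ≠ 0` and all directions `m` (`d ≥ 3`), from Lawler's asymptotics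
(1.37) in the tree's form `latticeGreen_second_diff_continuum` (main term `a_d((2−d)|z|^{−d} − d z_m²|z|^{−d−2})`,
`z_m² ≤ |z|²`, error `K|z|^{−d−1} ≤ K|z|^{−d}`). [folklore] -/
theorem abs_latticeGreen_second_diff_le (hd : 3 ≤ d) : ∃ C : ℝ, 0 ≤ C ∧ ∀ z : Literature.Probability.LatticeModels.Site d, z ≠ 0 → ∀ m : Fin d,
    |latticeGreen (z + Pi.single m 1) + latticeGreen (z - Pi.single m 1) - 2 * latticeGreen z| ≤
      C * Real.sqrt (∑ j, ((z j : ℤ) : ℝ) ^ 2) ^ (-(d : ℝ)) := by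
  obtain ⟨K, hK0, hK⟩ := latticeGreen_second_diff_continuum hd
  set a : ℝ := Real.Gamma ((d : ℝ) / 2 - 1) / (2 * π ^ ((d : ℝ) / 2)) with ha
  have ha0 : 0 ≤ a := by
    rw [ha]
    have h1 : 0 < Real.Gamma ((d : ℝ) / 2 - 1) := Real.Gamma_pos_of_pos (by
      have : (3 : ℝ) ≤ d := by exact_mod_cast hd
      linarith)
    positivity
  have hd0 : (0 : ℝ) ≤ d := by positivity
  have hd2 : (0 : ℝ) ≤ (d : ℝ) - 2 := by linarith [show (3 : ℝ) ≤ d by exact_mod_cast hd]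
  refine ⟨a * (((d : ℝ) - 2) * (1 + d)) + K, by positivity, fun z hz m => ?_⟩
  have h := hK z hz m
  set r : ℝ := Real.sqrt (∑ j, ((z j : ℤ) : ℝ) ^ 2) with hr
  have hr1 : 1 ≤ r := one_le_sqrt_sum_sq_of_ne_zero hz
  have hr0 : 0 < r := by linarith
  -- `z_m² ≤ r²`
  have hzm : ((z m : ℤ) : ℝ) ^ 2 ≤ r ^ (2 : ℝ) := by
    rw [hr, Real.rpow_two, Real.sq_sqrt (Finset.sum_nonneg fun j _ => sq_nonneg _)]
    exact Finset.single_le_sum (f := fun j => ((z j : ℤ) : ℝ) ^ 2) (fun j _ => sq_nonneg _) (Finset.mem_univ m)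
  have hpow1 : r ^ (2 : ℝ) * r ^ (-((d : ℝ) + 2)) = r ^ (-(d : ℝ)) := by
    rw [← Real.rpow_add hr0]; ring_nf
  -- the main term `M = a (2 - d) (r^{-d} - d z_m² r^{-d-2})` is at most `a (d - 2) (1 + d) r^{-d}` in absolute value
  set M : ℝ := a * ((2 - (d : ℝ)) * (r ^ (-(d : ℝ)) - d * ((z m : ℤ) : ℝ) ^ 2 * r ^ (-((d : ℝ) + 2)))) with hM
  have hB : (d : ℝ) * ((z m : ℤ) : ℝ) ^ 2 * r ^ (-((d : ℝ) + 2)) ≤ d * r ^ (-(d : ℝ)) := by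
    calc (d : ℝ) * ((z m : ℤ) : ℝ) ^ 2 * r ^ (-((d : ℝ) + 2))
        ≤ d * r ^ (2 : ℝ) * r ^ (-((d : ℝ) + 2)) := by
          refine mul_le_mul_of_nonneg_right (mul_le_mul_of_nonneg_left hzm hd0) (Real.rpow_nonneg hr0.le _)
      _ = d * r ^ (-(d : ℝ)) := by rw [mul_assoc, hpow1]
  have hBnn : 0 ≤ (d : ℝ) * ((z m : ℤ) : ℝ) ^ 2 * r ^ (-((d : ℝ) + 2)) := by positivity
  have hRnn : 0 ≤ r ^ (-(d : ℝ)) := Real.rpow_nonneg hr0.le _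
  have hmain : |M| ≤ a * (((d : ℝ) - 2) * (1 + d)) * r ^ (-(d : ℝ)) := by
    have hinner : |r ^ (-(d : ℝ)) - d * ((z m : ℤ) : ℝ) ^ 2 * r ^ (-((d : ℝ) + 2))| ≤ (1 + d) * r ^ (-(d : ℝ)) := by
      refine (abs_sub _ _).trans ?_
      rw [abs_of_nonneg hRnn, abs_of_nonneg hBnn]
      linarith
    rw [hM, abs_mul, abs_mul, abs_of_nonneg ha0,
      show |2 - (d : ℝ)| = (d : ℝ) - 2 by rw [abs_of_nonpos (by linarith), neg_sub]]
    calc a * (((d : ℝ) - 2) * |r ^ (-(d : ℝ)) - d * ((z m : ℤ) : ℝ) ^ 2 * r ^ (-((d : ℝ) + 2))|)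
        ≤ a * (((d : ℝ) - 2) * ((1 + d) * r ^ (-(d : ℝ)))) :=
          mul_le_mul_of_nonneg_left (mul_le_mul_of_nonneg_left hinner hd2) ha0
      _ = a * (((d : ℝ) - 2) * (1 + d)) * r ^ (-(d : ℝ)) := by ring
  -- the error term is at most `K r^{-d}`
  have herr : K * r ^ (-((d : ℝ) + 1)) ≤ K * r ^ (-(d : ℝ)) :=
    mul_le_mul_of_nonneg_left (Real.rpow_le_rpow_of_exponent_le hr1 (by linarith)) hK0
  -- triangle inequality
  have htri := abs_sub_abs_le_abs_sub
    (latticeGreen (z + Pi.single m 1) + latticeGreen (z - Pi.single m 1) - 2 * latticeGreen z) M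
  calc |latticeGreen (z + Pi.single m 1) + latticeGreen (z - Pi.single m 1) - 2 * latticeGreen z|
      ≤ |M| + K * r ^ (-((d : ℝ) + 1)) := by linarith
    _ ≤ a * (((d : ℝ) - 2) * (1 + d)) * r ^ (-(d : ℝ)) + K * r ^ (-(d : ℝ)) := add_le_add hmain herr
    _ = (a * (((d : ℝ) - 2) * (1 + d)) + K) * r ^ (-(d : ℝ)) := by ring

/-- **Decay of the curvature two-point kernel between parallel plaquettes**: there is `C` with
`|curvatureTwoPoint (x; i,j) (y; i,j)| ≤ C |x − y|^{−d}` for all `x ≠ y` (`d ≥ 3`; `|·|` Euclidean). [folklore] -/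
theorem exists_abs_curvatureTwoPoint_parallel_le (hd : 3 ≤ d) : ∃ C : ℝ, 0 ≤ C ∧
    ∀ (x y : Literature.Probability.LatticeModels.Site d) (ij : {p : Fin d × Fin d // p.1 < p.2}), x ≠ y →
      |curvatureTwoPoint ((x, ij) : ZdPlaquette d) (y, ij)| ≤
        C * Real.sqrt (∑ k, (((x - y) k : ℤ) : ℝ) ^ 2) ^ (-(d : ℝ)) := by
  obtain ⟨C, hC0, hC⟩ := abs_latticeGreen_second_diff_le hd
  refine ⟨C, hC0, fun x y ij hxy => ?_⟩
  have hz : x - y ≠ 0 := sub_ne_zero.2 hxy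
  rw [curvatureTwoPoint_parallel_eq]
  have h1 := hC (x - y) hz ij.1.1
  have h2 := hC (x - y) hz ij.1.2
  have hnn : 0 ≤ C * Real.sqrt (∑ k, (((x - y) k : ℤ) : ℝ) ^ 2) ^ (-(d : ℝ)) :=
    mul_nonneg hC0 (Real.rpow_nonneg (Real.sqrt_nonneg _) _)
  rw [abs_div, abs_neg, abs_two]
  have := abs_add_le
    (latticeGreen (x - y + Pi.single ij.1.1 1) + latticeGreen (x - y - Pi.single ij.1.1 1) - 2 * latticeGreen (x - y))
    (latticeGreen (x - y + Pi.single ij.1.2 1) + latticeGreen (x - y - Pi.single ij.1.2 1) - 2 * latticeGreen (x - y))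
  calc _ ≤ (C * Real.sqrt (∑ k, (((x - y) k : ℤ) : ℝ) ^ 2) ^ (-(d : ℝ)) +
        C * Real.sqrt (∑ k, (((x - y) k : ℤ) : ℝ) ^ 2) ^ (-(d : ℝ))) / 2 := by
        exact div_le_div_of_nonneg_right (this.trans (add_le_add h1 h2)) zero_le_two
    _ = C * Real.sqrt (∑ k, (((x - y) k : ℤ) : ℝ) ^ 2) ^ (-(d : ℝ)) := by ring

/-- **Uniform form of the decay**: there is `C` with `|curvatureTwoPoint (x; i,j) (y; i,j)| ≤ C (1 + |x − y|)^{−d}` for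
ALL `x, y` (the diagonal value is `2/d`, `curvatureTwoPoint_self`; off the diagonal `|x−y|^{−d} ≤ 2^d (1+|x−y|)^{−d}`).
[folklore] -/
theorem exists_abs_curvatureTwoPoint_parallel_le_one_add (hd : 3 ≤ d) : ∃ C : ℝ, 0 ≤ C ∧
    ∀ (x y : Literature.Probability.LatticeModels.Site d) (ij : {p : Fin d × Fin d // p.1 < p.2}),
      |curvatureTwoPoint ((x, ij) : ZdPlaquette d) (y, ij)| ≤
        C * (1 + Real.sqrt (∑ k, (((x - y) k : ℤ) : ℝ) ^ 2)) ^ (-(d : ℝ)) := by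
  obtain ⟨C, hC0, hC⟩ := exists_abs_curvatureTwoPoint_parallel_le hd
  have hd0 : (0 : ℝ) ≤ d := by positivity
  refine ⟨max (2 / (d : ℝ)) (C * 2 ^ (d : ℝ)), le_max_of_le_left (by positivity), fun x y ij => ?_⟩
  set r : ℝ := Real.sqrt (∑ k, (((x - y) k : ℤ) : ℝ) ^ 2) with hr
  have hr0 : 0 ≤ r := Real.sqrt_nonneg _
  by_cases hxy : x = y
  · subst hxy
    have hr' : r = 0 := by simp [hr]
    rw [curvatureTwoPoint_self hd, hr', add_zero, Real.one_rpow, mul_one, abs_of_nonneg (by positivity)]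
    exact le_max_left _ _
  · have h := hC x y ij hxy
    have hr1 : 1 ≤ r := one_le_sqrt_sum_sq_of_ne_zero (sub_ne_zero.2 hxy)
    have hrpos : 0 < r := by linarith
    -- `r^{-d} ≤ 2^d (1+r)^{-d}` since `1 + r ≤ 2 r`
    have hkey : r ^ (-(d : ℝ)) ≤ 2 ^ (d : ℝ) * (1 + r) ^ (-(d : ℝ)) := by
      have h2r : 1 + r ≤ 2 * r := by linarith
      have hq : (1 + r) ^ (d : ℝ) ≤ (2 * r) ^ (d : ℝ) := Real.rpow_le_rpow (by linarith) h2r hd0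
      rw [Real.mul_rpow (by norm_num) hr0] at hq
      have h1r : (0 : ℝ) < 1 + r := by linarith
      rw [Real.rpow_neg hrpos.le, Real.rpow_neg h1r.le, ← div_eq_mul_inv, inv_eq_one_div,
        div_le_div_iff₀ (Real.rpow_pos_of_pos hrpos _) (Real.rpow_pos_of_pos h1r _), one_mul]
      exact hq
    calc |curvatureTwoPoint ((x, ij) : ZdPlaquette d) (y, ij)| ≤ C * r ^ (-(d : ℝ)) := h
      _ ≤ C * (2 ^ (d : ℝ) * (1 + r) ^ (-(d : ℝ))) := mul_le_mul_of_nonneg_left hkey hC0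
      _ = (C * 2 ^ (d : ℝ)) * (1 + r) ^ (-(d : ℝ)) := by ring
      _ ≤ max (2 / (d : ℝ)) (C * 2 ^ (d : ℝ)) * (1 + r) ^ (-(d : ℝ)) :=
          mul_le_mul_of_nonneg_right (le_max_right _ _) (Real.rpow_nonneg (by linarith) _)

/-- **The axis plaquette numbers decay like `|n|^{−d}`**: `|curvaturePlaquetteCorr d n| ≤ C |n|^{−d}` for `n ≠ 0` — the
ceiling matching the tree's floor `κ/n⁴ ≤ |c_n|` (`WeakCouplingRates.curvatureCorrPowerFloor_proof`, `d = 4`). [folklore] -/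
theorem abs_curvaturePlaquetteCorr_le (hd : 3 ≤ d) : ∃ C : ℝ, 0 ≤ C ∧ ∀ n : ℤ, n ≠ 0 →
    |curvaturePlaquetteCorr hd n| ≤ C * (|(n : ℝ)|) ^ (-(d : ℝ)) := by
  obtain ⟨C, hC0, hC⟩ := exists_abs_curvatureTwoPoint_parallel_le hd
  refine ⟨C, hC0, fun n hn => ?_⟩
  set i0 : Fin d := ⟨0, by omega⟩ with hi0
  set v : Literature.Probability.LatticeModels.Site d := Pi.single i0 n with hv
  have hne : (0 : Literature.Probability.LatticeModels.Site d) ≠ v := by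
    intro h
    have := congrFun h i0
    simp [hv] at this
    exact hn this.symm
  have h := hC 0 v ⟨(⟨1, by omega⟩, ⟨2, by omega⟩), Fin.mk_lt_mk.2 one_lt_two⟩ hne
  have hsum : ∑ k : Fin d, (((((0 : Literature.Probability.LatticeModels.Site d) - v) k : ℤ) : ℝ) ^ 2) = (n : ℝ) ^ 2 := by
    rw [Finset.sum_eq_single i0]
    · simp [hv]
    · intro k _ hk; simp [hv, hk]
    · intro h; exact absurd (Finset.mem_univ _) h
  rw [hsum, Real.sqrt_sq_eq_abs] at h
  simpa [curvaturePlaquetteCorr, plaquette12, hv, hi0] using h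

end Summit.QuantumFields.YangMills.Cruxes.SourcedPressureIncrement.Birth
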